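import Mathlib
import Summits.Ventures.PercRepro2.OneEdge
import Summits.Ventures.PercRepro2.KPrimeReduction
import Summits.Ventures.PercRepro2.KPrimeSure
import Summits.Ventures.PercRepro2.KPrimeEdgeSteps
import Summits.Ventures.PercRepro2.KPrimeVBase
import Summits.Ventures.PercRepro2.KPrimePendantLemmas
import Summits.Ventures.PercRepro2.KPrimePendant
import Summits.Ventures.PercRepro2.KPrimeLeafMartingale
import Summits.Ventures.PercRepro2.KPrimePendantTCore

/-!
# The IMPROVED pendant step of the `v`-exploration of `(K′)`: `(K′)_z ∧ (K′-T)_z ⟹ (K′)_v`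
(blind cell PercRepro2, mine-c g34; `conjectures/MINE-C.md` §43.1)

`kprime_of_pendant_T`: the pendant theorem `kprime_of_pendant` of `KPrimePendant.lean` (§42.5) with
its hypothesis `(K′-Ω+)` of the `z`-instance WEAKENED to `(K′-T)` (`KPrimeTHolds`,
`KPrimeLeafMartingale.lean`): if `v` is a leaf whose only edge is `e = {v, z}`, and the `z`-instance
(the graph with `e` pinned closed, `z` in the role of `v`) satisfies `(K′)` and `(K′-T)`, then the
leaf instance satisfies `(K′)` for EVERY weight of `e`.  The proof is the pendant dictionary of
`KPrimePendant.lean` (world 0: `v` isolated — the `U`-masses vanish, `S = N = Ω`, the classes collapse;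
world 1: the `v`-events are the `z`-events, flip-invariant at `e`) followed by the algebraic core
`pendant_core_T` (`KPrimePendantTCore.lean`), which keeps the `D`-term of the pendant identity that
`pendant_core` dropped.  Together with `kprimeT_of_leaf`, `(K′) ∧ (K′-T)` for the `z`-instance gives
`(K′) ∧ (K′-T)` for every leaf extension at every weight.
-/

namespace Summit.Ventures.PercRepro2

namespace KPrime

variable {V : Type*} {E : Type*} [Fintype E] [DecidableEq E] [Fintype V] [DecidableEq V]
  {R : Type*} [Field R] [LinearOrder R] [IsStrictOrderedRing R]

section PendantStepT

variable {ends : E → Sym2 V} {a₁ a₂ b v y z : V} {p : E → R} {e : E}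

/-- **The improved pendant step**: `(K′)` and `(K′-T)` for the `z`-instance (the pendant edge pinned
closed, `z` in the role of `v`) give `(K′)` for the instance with the leaf `v` at `z`, at every
weight of the pendant edge (`MINE-C.md` §43.1; the identity `pendant_core_T`). -/
theorem kprime_of_pendant_T (hp : IsProbVec p) (hleaf : ∀ f, v ∈ ends f → f = e)
    (hends : ends e = s(v, z)) (he : p e ≠ 1) (hvz : v ≠ z) (ha₁ : a₁ ≠ v) (ha₂ : a₂ ≠ v)
    (hb : b ≠ v) (hy : y ≠ v)
    (hO : 0 < prob (Function.update p e 0) (Ω ends a₁ a₂))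
    (hNz : 0 < prob (Function.update p e 0) (N ends a₁ a₂ z))
    (hSz : 0 < prob (Function.update p e 0) (S ends a₁ a₂ z))
    (H1 : KPrimeHolds ends a₁ a₂ b z y (Function.update p e 0))
    (H2T : KPrimeTHolds ends a₁ a₂ b z y (Function.update p e 0)) :
    KPrimeHolds ends a₁ a₂ b v y p := by
  have hp0v : IsProbVec (Function.update p e 0) := hp.update e le_rfl zero_le_one
  -- sure facts with `e` pinned closed: `v` is isolated
  have iso : ∀ {ω : Config E}, ω ∈ sureSet (Function.update p e 0) → ∀ {x : V},
      Conn ends ω x v → x = v := by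
    intro ω hω x h
    exact conn_eq_of_isolated hleaf (hω.2 e (by simp)) (conn_symm h)
  -- sure facts with `e` pinned open: `v` is what `z` is
  have dict : ∀ {ω : Config E}, ω ∈ sureSet (Function.update p e 1) → ∀ {a : V}, a ≠ v →
      (Conn ends ω a v ↔ Conn ends ω a z) := by
    intro ω hω a ha
    exact conn_v_iff_conn_z_of_mem_sureSet_update_one hleaf hends hvz hω ha
  /- ## world 0: the `U`-masses vanish, `S = N = Ω`, the classes -/
  have z1 : prob (Function.update p e 0)
      (connEvent ends a₁ v ∩ connEvent ends a₁ b ∩ Ω ends a₁ a₂) = 0 :=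
    prob_update_zero_eq_zero_of_subset_U hleaf ha₁ (fun ω hω => hω.1.1)
  have z2 : prob (Function.update p e 0) (connEvent ends a₁ v ∩ Ω ends a₁ a₂) = 0 :=
    prob_update_zero_eq_zero_of_subset_U hleaf ha₁ (fun ω hω => hω.1)
  have z3 : prob (Function.update p e 0) (connEvent ends a₁ v ∩ connEvent ends a₂ y ∩
      connEvent ends a₁ b ∩ Ω ends a₁ a₂) = 0 :=
    prob_update_zero_eq_zero_of_subset_U hleaf ha₁ (fun ω hω => hω.1.1.1)
  have z4 : prob (Function.update p e 0)
      (connEvent ends a₁ v ∩ connEvent ends a₂ y ∩ Ω ends a₁ a₂) = 0 :=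
    prob_update_zero_eq_zero_of_subset_U hleaf ha₁ (fun ω hω => hω.1.1)
  have eS0 : prob (Function.update p e 0) (S ends a₁ a₂ v) =
      prob (Function.update p e 0) (Ω ends a₁ a₂) := by
    apply prob_congr_sure; ext ω
    simp only [Set.mem_inter_iff, mem_S, mem_Ω]
    constructor
    · rintro ⟨⟨ha, _⟩, hs⟩; exact ⟨fun h => ha (conn_symm h), hs⟩
    · rintro ⟨ha, hs⟩; exact ⟨⟨fun h => ha (conn_symm h), fun h => ha₂ (iso hs h)⟩, hs⟩
  have eYS0 : prob (Function.update p e 0) (connEvent ends a₂ y ∩ S ends a₁ a₂ v) =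
      prob (Function.update p e 0) (connEvent ends a₂ y ∩ Ω ends a₁ a₂) := by
    apply prob_congr_sure; ext ω
    simp only [Set.mem_inter_iff, mem_S, mem_Ω, mem_connEvent]
    constructor
    · rintro ⟨⟨hy', ha, _⟩, hs⟩; exact ⟨⟨hy', fun h => ha (conn_symm h)⟩, hs⟩
    · rintro ⟨⟨hy', ha⟩, hs⟩
      exact ⟨⟨hy', fun h => ha (conn_symm h), fun h => ha₂ (iso hs h)⟩, hs⟩
  have eN0 : prob (Function.update p e 0) (N ends a₁ a₂ v) =
      prob (Function.update p e 0) (Ω ends a₁ a₂) := by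
    apply prob_congr_sure; ext ω
    simp only [Set.mem_inter_iff, mem_N, mem_Ω]
    constructor
    · rintro ⟨⟨ha, _⟩, hs⟩; exact ⟨ha, hs⟩
    · rintro ⟨ha, hs⟩; exact ⟨⟨ha, fun h => ha₁ (iso hs h)⟩, hs⟩
  have eXN0 : prob (Function.update p e 0) (connEvent ends a₁ b ∩ N ends a₁ a₂ v) =
      prob (Function.update p e 0) (connEvent ends a₁ b ∩ Ω ends a₁ a₂) := by
    apply prob_congr_sure; ext ω
    simp only [Set.mem_inter_iff, mem_N, mem_Ω]
    constructor
    · rintro ⟨⟨hb', ha, _⟩, hs⟩; exact ⟨⟨hb', ha⟩, hs⟩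
    · rintro ⟨⟨hb', ha⟩, hs⟩; exact ⟨⟨hb', ha, fun h => ha₁ (iso hs h)⟩, hs⟩
  have e010 : prob (Function.update p e 0) (cls01 ends a₁ a₂ v y) =
      prob (Function.update p e 0) (connEvent ends a₁ y ∩ Ω ends a₁ a₂) := by
    apply prob_congr_sure; ext ω
    simp only [cls01, Set.mem_inter_iff, Set.mem_compl_iff, mem_connEvent, mem_S, mem_Ω]
    constructor
    · rintro ⟨⟨⟨_, hy'⟩, ha, _⟩, hs⟩; exact ⟨⟨hy', fun h => ha (conn_symm h)⟩, hs⟩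
    · rintro ⟨⟨hy', ha⟩, hs⟩
      exact ⟨⟨⟨fun h => ha₁ (iso hs h), hy'⟩, fun h => ha (conn_symm h), fun h => ha₂ (iso hs h)⟩,
        hs⟩
  have e01e0 : prob (Function.update p e 0) (cls01e ends a₁ a₂ b v y) =
      prob (Function.update p e 0) (connEvent ends a₁ b ∩ connEvent ends a₁ y ∩ Ω ends a₁ a₂) := by
    apply prob_congr_sure; ext ω
    simp only [cls01e, Set.mem_inter_iff, Set.mem_compl_iff, Set.mem_union, mem_connEvent, mem_S,
      mem_Ω]
    constructor
    · rintro ⟨⟨⟨⟨_, hy'⟩, ha, _⟩, hbb⟩, hs⟩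
      refine ⟨⟨⟨?_, hy'⟩, fun h => ha (conn_symm h)⟩, hs⟩
      rcases hbb with h | h
      · exact h
      · exact absurd (iso hs (conn_symm h)) hb
    · rintro ⟨⟨⟨hbb, hy'⟩, ha⟩, hs⟩
      exact ⟨⟨⟨⟨fun h => ha₁ (iso hs h), hy'⟩, fun h => ha (conn_symm h), fun h => ha₂ (iso hs h)⟩,
        Or.inl hbb⟩, hs⟩
  /- ## world 1: the `v`-events are the `z`-events, whose masses are flip-invariant -/
  have hz1 : z ≠ v := fun h => hvz h.symm
  have fa₁ : ∀ x, x ≠ v → FlipInvAt p e (connEvent ends a₁ x) :=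
    fun x hx => flipInvAt_connEvent hleaf hends ha₁ hx
  have fa₂ : ∀ x, x ≠ v → FlipInvAt p e (connEvent ends a₂ x) :=
    fun x hx => flipInvAt_connEvent hleaf hends ha₂ hx
  have fΩ : FlipInvAt p e (Ω ends a₁ a₂) :=
    flipInvAt_avoidAll hleaf hends ha₁ (by simp [ha₂])
  have fSz : FlipInvAt p e (S ends a₁ a₂ z) :=
    flipInvAt_avoidAll hleaf hends ha₂ (by simp [ha₁, hz1])
  have fNz : FlipInvAt p e (N ends a₁ a₂ z) :=
    flipInvAt_avoidAll hleaf hends ha₁ (by simp [ha₂, hz1])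
  have fzb : FlipInvAt p e (connEvent ends z b) := flipInvAt_connEvent hleaf hends hz1 hb
  have f01 : FlipInvAt p e (cls01 ends a₁ a₂ z y) :=
    ((fa₁ z hz1).compl.inter (fa₁ y hy)).inter fSz
  have f01e : FlipInvAt p e (cls01e ends a₁ a₂ b z y) :=
    f01.inter ((fa₁ b hb).union fzb)
  have flip : ∀ {A : Set (Config E)}, FlipInvAt p e A →
      prob (Function.update p e 1) A = prob (Function.update p e 0) A :=
    fun hA => prob_update_one_eq_update_zero_of_flipInvAt he hA
  -- the dictionary, event by event (on the sure set of `e` pinned open)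
  have d1 : prob (Function.update p e 1) (connEvent ends a₁ v ∩ connEvent ends a₁ b ∩ Ω ends a₁ a₂)
      = prob (Function.update p e 0) (connEvent ends a₁ b ∩ connEvent ends a₁ z ∩ Ω ends a₁ a₂) := by
    rw [← flip (((fa₁ b hb).inter (fa₁ z hz1)).inter fΩ)]
    apply prob_congr_sure; ext ω
    simp only [Set.mem_inter_iff, mem_connEvent]
    constructor
    · rintro ⟨⟨⟨hu, hx⟩, hΩ⟩, hs⟩; exact ⟨⟨⟨hx, (dict hs ha₁).1 hu⟩, hΩ⟩, hs⟩
    · rintro ⟨⟨⟨hx, hu⟩, hΩ⟩, hs⟩; exact ⟨⟨⟨(dict hs ha₁).2 hu, hx⟩, hΩ⟩, hs⟩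
  have d2 : prob (Function.update p e 1) (connEvent ends a₁ v ∩ Ω ends a₁ a₂) =
      prob (Function.update p e 0) (connEvent ends a₁ z ∩ Ω ends a₁ a₂) := by
    rw [← flip ((fa₁ z hz1).inter fΩ)]
    apply prob_congr_sure; ext ω
    simp only [Set.mem_inter_iff, mem_connEvent]
    constructor
    · rintro ⟨⟨hu, hΩ⟩, hs⟩; exact ⟨⟨(dict hs ha₁).1 hu, hΩ⟩, hs⟩
    · rintro ⟨⟨hu, hΩ⟩, hs⟩; exact ⟨⟨(dict hs ha₁).2 hu, hΩ⟩, hs⟩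
  have d3 : prob (Function.update p e 1) (connEvent ends a₁ v ∩ connEvent ends a₂ y ∩
      connEvent ends a₁ b ∩ Ω ends a₁ a₂) =
      prob (Function.update p e 0) (connEvent ends a₁ z ∩ connEvent ends a₂ y ∩
        connEvent ends a₁ b ∩ Ω ends a₁ a₂) := by
    rw [← flip ((((fa₁ z hz1).inter (fa₂ y hy)).inter (fa₁ b hb)).inter fΩ)]
    apply prob_congr_sure; ext ω
    simp only [Set.mem_inter_iff, mem_connEvent]
    constructor
    · rintro ⟨⟨⟨⟨hu, hy'⟩, hx⟩, hΩ⟩, hs⟩; exact ⟨⟨⟨⟨(dict hs ha₁).1 hu, hy'⟩, hx⟩, hΩ⟩, hs⟩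
    · rintro ⟨⟨⟨⟨hu, hy'⟩, hx⟩, hΩ⟩, hs⟩; exact ⟨⟨⟨⟨(dict hs ha₁).2 hu, hy'⟩, hx⟩, hΩ⟩, hs⟩
  have d4 : prob (Function.update p e 1) (connEvent ends a₁ v ∩ connEvent ends a₂ y ∩ Ω ends a₁ a₂)
      = prob (Function.update p e 0) (connEvent ends a₁ z ∩ connEvent ends a₂ y ∩ Ω ends a₁ a₂) := by
    rw [← flip (((fa₁ z hz1).inter (fa₂ y hy)).inter fΩ)]
    apply prob_congr_sure; ext ω
    simp only [Set.mem_inter_iff, mem_connEvent]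
    constructor
    · rintro ⟨⟨⟨hu, hy'⟩, hΩ⟩, hs⟩; exact ⟨⟨⟨(dict hs ha₁).1 hu, hy'⟩, hΩ⟩, hs⟩
    · rintro ⟨⟨⟨hu, hy'⟩, hΩ⟩, hs⟩; exact ⟨⟨⟨(dict hs ha₁).2 hu, hy'⟩, hΩ⟩, hs⟩
  have dS : prob (Function.update p e 1) (S ends a₁ a₂ v) =
      prob (Function.update p e 0) (S ends a₁ a₂ z) := by
    rw [← flip fSz]
    apply prob_congr_sure; ext ω
    simp only [Set.mem_inter_iff, mem_S]
    constructor
    · rintro ⟨⟨ha, hv'⟩, hs⟩; exact ⟨⟨ha, fun h => hv' ((dict hs ha₂).2 h)⟩, hs⟩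
    · rintro ⟨⟨ha, hz'⟩, hs⟩; exact ⟨⟨ha, fun h => hz' ((dict hs ha₂).1 h)⟩, hs⟩
  have dYS : prob (Function.update p e 1) (connEvent ends a₂ y ∩ S ends a₁ a₂ v) =
      prob (Function.update p e 0) (connEvent ends a₂ y ∩ S ends a₁ a₂ z) := by
    rw [← flip ((fa₂ y hy).inter fSz)]
    apply prob_congr_sure; ext ω
    simp only [Set.mem_inter_iff, mem_S, mem_connEvent]
    constructor
    · rintro ⟨⟨hy', ha, hv'⟩, hs⟩; exact ⟨⟨hy', ha, fun h => hv' ((dict hs ha₂).2 h)⟩, hs⟩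
    · rintro ⟨⟨hy', ha, hz'⟩, hs⟩; exact ⟨⟨hy', ha, fun h => hz' ((dict hs ha₂).1 h)⟩, hs⟩
  have dN : prob (Function.update p e 1) (N ends a₁ a₂ v) =
      prob (Function.update p e 0) (N ends a₁ a₂ z) := by
    rw [← flip fNz]
    apply prob_congr_sure; ext ω
    simp only [Set.mem_inter_iff, mem_N]
    constructor
    · rintro ⟨⟨ha, hv'⟩, hs⟩; exact ⟨⟨ha, fun h => hv' ((dict hs ha₁).2 h)⟩, hs⟩
    · rintro ⟨⟨ha, hz'⟩, hs⟩; exact ⟨⟨ha, fun h => hz' ((dict hs ha₁).1 h)⟩, hs⟩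
  have dXN : prob (Function.update p e 1) (connEvent ends a₁ b ∩ N ends a₁ a₂ v) =
      prob (Function.update p e 0) (connEvent ends a₁ b ∩ N ends a₁ a₂ z) := by
    rw [← flip ((fa₁ b hb).inter fNz)]
    apply prob_congr_sure; ext ω
    simp only [Set.mem_inter_iff, mem_N, mem_connEvent]
    constructor
    · rintro ⟨⟨hb', ha, hv'⟩, hs⟩; exact ⟨⟨hb', ha, fun h => hv' ((dict hs ha₁).2 h)⟩, hs⟩
    · rintro ⟨⟨hb', ha, hz'⟩, hs⟩; exact ⟨⟨hb', ha, fun h => hz' ((dict hs ha₁).1 h)⟩, hs⟩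
  have d01 : prob (Function.update p e 1) (cls01 ends a₁ a₂ v y) =
      prob (Function.update p e 0) (cls01 ends a₁ a₂ z y) := by
    rw [← flip f01]
    apply prob_congr_sure; ext ω
    simp only [cls01, Set.mem_inter_iff, Set.mem_compl_iff, mem_connEvent, mem_S]
    constructor
    · rintro ⟨⟨⟨hu, hy'⟩, ha, hv'⟩, hs⟩
      exact ⟨⟨⟨fun h => hu ((dict hs ha₁).2 h), hy'⟩, ha, fun h => hv' ((dict hs ha₂).2 h)⟩, hs⟩
    · rintro ⟨⟨⟨hu, hy'⟩, ha, hz'⟩, hs⟩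
      exact ⟨⟨⟨fun h => hu ((dict hs ha₁).1 h), hy'⟩, ha, fun h => hz' ((dict hs ha₂).1 h)⟩, hs⟩
  have d01e : prob (Function.update p e 1) (cls01e ends a₁ a₂ b v y) =
      prob (Function.update p e 0) (cls01e ends a₁ a₂ b z y) := by
    rw [← flip f01e]
    apply prob_congr_sure; ext ω
    simp only [cls01e, Set.mem_inter_iff, Set.mem_compl_iff, Set.mem_union, mem_connEvent, mem_S]
    constructor
    · rintro ⟨⟨⟨⟨hu, hy'⟩, ha, hv'⟩, hbb⟩, hs⟩
      refine ⟨⟨⟨⟨fun h => hu ((dict hs ha₁).2 h), hy'⟩, ha, fun h => hv' ((dict hs ha₂).2 h)⟩, ?_⟩,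
        hs⟩
      rcases hbb with h | h
      · exact Or.inl h
      · exact Or.inr (conn_symm ((dict hs hb).1 (conn_symm h)))
    · rintro ⟨⟨⟨⟨hu, hy'⟩, ha, hz'⟩, hbb⟩, hs⟩
      refine ⟨⟨⟨⟨fun h => hu ((dict hs ha₁).1 h), hy'⟩, ha, fun h => hz' ((dict hs ha₂).1 h)⟩, ?_⟩,
        hs⟩
      rcases hbb with h | h
      · exact Or.inl h
      · exact Or.inr (conn_symm ((dict hs hb).2 (conn_symm h)))
  /- ## the three van den Berg–Kahn inequalities and the complement decompositions -/
  have hΩc := Ω_eq_compl (ends := ends) (a₁ := a₁) (a₂ := a₂)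
  have vC := vdBK_pair (Function.update p e 0) hp0v ends a₁ b y a₂
  rw [← hΩc] at vC
  have vZ := vdBK_pair (Function.update p e 0) hp0v ends a₁ b z a₂
  rw [← hΩc] at vZ
  have vY := vdBK_pair (Function.update p e 0) hp0v ends a₂ y z a₁
  have hΩ' : (connEvent ends a₂ a₁)ᶜ = Ω ends a₁ a₂ := by
    ext ω; simp only [Set.mem_compl_iff, mem_connEvent, mem_Ω]
    exact ⟨fun h hc => h (conn_symm hc), fun h hc => h (conn_symm hc)⟩
  rw [hΩ'] at vY
  have hNz' : N ends a₁ a₂ z = Ω ends a₁ a₂ ∩ (connEvent ends a₁ z)ᶜ := by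
    ext ω; simp only [mem_N, Set.mem_inter_iff, mem_Ω, Set.mem_compl_iff, mem_connEvent]
  have hSz' : S ends a₁ a₂ z = Ω ends a₁ a₂ ∩ (connEvent ends a₂ z)ᶜ := by
    ext ω; simp only [mem_S, Set.mem_inter_iff, mem_Ω, Set.mem_compl_iff, mem_connEvent]
    exact ⟨fun h => ⟨fun hc => h.1 (conn_symm hc), h.2⟩, fun h => ⟨fun hc => h.1 (conn_symm hc), h.2⟩⟩
  have cN : prob (Function.update p e 0) (connEvent ends a₁ z ∩ Ω ends a₁ a₂) +
      prob (Function.update p e 0) (N ends a₁ a₂ z) = prob (Function.update p e 0) (Ω ends a₁ a₂) := by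
    rw [hNz', Set.inter_comm (connEvent ends a₁ z)]; exact prob_inter_add_prob_inter_compl _ _ _
  have cXN : prob (Function.update p e 0) (connEvent ends a₁ b ∩ connEvent ends a₁ z ∩ Ω ends a₁ a₂) +
      prob (Function.update p e 0) (connEvent ends a₁ b ∩ N ends a₁ a₂ z) =
      prob (Function.update p e 0) (connEvent ends a₁ b ∩ Ω ends a₁ a₂) := by
    have e1 : connEvent ends a₁ b ∩ connEvent ends a₁ z ∩ Ω ends a₁ a₂ =
        connEvent ends a₁ b ∩ Ω ends a₁ a₂ ∩ connEvent ends a₁ z := by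
      rw [Set.inter_assoc, Set.inter_comm (connEvent ends a₁ z), ← Set.inter_assoc]
    rw [e1, hNz', ← Set.inter_assoc]; exact prob_inter_add_prob_inter_compl _ _ _
  have cS : prob (Function.update p e 0) (connEvent ends a₂ z ∩ Ω ends a₁ a₂) +
      prob (Function.update p e 0) (S ends a₁ a₂ z) = prob (Function.update p e 0) (Ω ends a₁ a₂) := by
    rw [hSz', Set.inter_comm (connEvent ends a₂ z)]; exact prob_inter_add_prob_inter_compl _ _ _
  have cYS : prob (Function.update p e 0) (connEvent ends a₂ y ∩ connEvent ends a₂ z ∩ Ω ends a₁ a₂) +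
      prob (Function.update p e 0) (connEvent ends a₂ y ∩ S ends a₁ a₂ z) =
      prob (Function.update p e 0) (connEvent ends a₂ y ∩ Ω ends a₁ a₂) := by
    have e1 : connEvent ends a₂ y ∩ connEvent ends a₂ z ∩ Ω ends a₁ a₂ =
        connEvent ends a₂ y ∩ Ω ends a₁ a₂ ∩ connEvent ends a₂ z := by
      rw [Set.inter_assoc, Set.inter_comm (connEvent ends a₂ z), ← Set.inter_assoc]
    rw [e1, hSz', ← Set.inter_assoc]; exact prob_inter_add_prob_inter_compl _ _ _
  /- ## the algebra -/
  have e5 : connEvent ends a₁ z ∩ connEvent ends a₁ b ∩ Ω ends a₁ a₂ =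
      connEvent ends a₁ b ∩ connEvent ends a₁ z ∩ Ω ends a₁ a₂ := by
    rw [Set.inter_comm (connEvent ends a₁ z)]
  unfold KPrimeHolds at H1 ⊢
  unfold KPrimeTHolds mtForm at H2T
  unfold kprimeForm at H1 ⊢
  rw [e5] at H1 H2T
  rw [prob_eq_pin p (connEvent ends a₁ v ∩ connEvent ends a₁ b ∩ Ω ends a₁ a₂) e,
    prob_eq_pin p (connEvent ends a₁ v ∩ Ω ends a₁ a₂) e,
    prob_eq_pin p (connEvent ends a₂ y ∩ S ends a₁ a₂ v) e,
    prob_eq_pin p (S ends a₁ a₂ v) e,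
    prob_eq_pin p (cls01e ends a₁ a₂ b v y) e, prob_eq_pin p (cls01 ends a₁ a₂ v y) e,
    prob_eq_pin p (connEvent ends a₁ v ∩ connEvent ends a₂ y ∩ connEvent ends a₁ b ∩ Ω ends a₁ a₂) e,
    prob_eq_pin p (connEvent ends a₁ v ∩ connEvent ends a₂ y ∩ Ω ends a₁ a₂) e,
    prob_eq_pin p (connEvent ends a₁ b ∩ N ends a₁ a₂ v) e, prob_eq_pin p (N ends a₁ a₂ v) e]
  rw [z1, z2, z3, z4, eS0, eYS0, eN0, eXN0, e010, e01e0, d1, d2, d3, d4, dS, dYS, dN, dXN, d01, d01e]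
  have hZ2O : 0 ≤ prob (Function.update p e 0) (connEvent ends a₂ z ∩ Ω ends a₁ a₂) :=
    prob_nonneg hp0v _
  have core := pendant_core_T (p e) (prob (Function.update p e 0) (Ω ends a₁ a₂))
    (prob (Function.update p e 0) (connEvent ends a₁ b ∩ Ω ends a₁ a₂))
    (prob (Function.update p e 0) (connEvent ends a₁ y ∩ Ω ends a₁ a₂))
    (prob (Function.update p e 0) (connEvent ends a₁ b ∩ connEvent ends a₁ y ∩ Ω ends a₁ a₂))
    (prob (Function.update p e 0) (connEvent ends a₂ y ∩ Ω ends a₁ a₂))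
    (prob (Function.update p e 0) (S ends a₁ a₂ z))
    (prob (Function.update p e 0) (connEvent ends a₂ y ∩ S ends a₁ a₂ z))
    (prob (Function.update p e 0) (N ends a₁ a₂ z))
    (prob (Function.update p e 0) (connEvent ends a₁ b ∩ N ends a₁ a₂ z))
    (prob (Function.update p e 0) (connEvent ends a₁ b ∩ connEvent ends a₁ z ∩ Ω ends a₁ a₂))
    (prob (Function.update p e 0) (connEvent ends a₁ z ∩ Ω ends a₁ a₂))
    (prob (Function.update p e 0) (cls01e ends a₁ a₂ b z y))
    (prob (Function.update p e 0) (cls01 ends a₁ a₂ z y))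
    (prob (Function.update p e 0)
      (connEvent ends a₁ z ∩ connEvent ends a₂ y ∩ connEvent ends a₁ b ∩ Ω ends a₁ a₂))
    (prob (Function.update p e 0) (connEvent ends a₁ z ∩ connEvent ends a₂ y ∩ Ω ends a₁ a₂))
    (prob (Function.update p e 0) (connEvent ends a₂ z ∩ Ω ends a₁ a₂))
    (prob (Function.update p e 0) (connEvent ends a₂ y ∩ connEvent ends a₂ z ∩ Ω ends a₁ a₂))
    (hp.nonneg e) (hp.le_one e) hO hNz hSz hZ2O vC vZ cN cXN vY cS cYS H1 H2T
  linarith [core]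

end PendantStepT

end KPrime

end Summit.Ventures.PercRepro2
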